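import Literature.Geometry.Symplectic.TaubesFamilyCrossTerm
import Literature.Geometry.Symplectic.TaubesFamilyDiracBetaEnergy
import Literature.Geometry.Kaehler.ManifoldFormsChart
import Literature.NumberTheory.Transcendental.FormIntegrationPositivity
import HarnessLib

/-!
# Uniqueness of the Taubes solution for large `r`: Hutchings–Taubes (4.16)–(4.19)

Topic `Literature/Geometry/Symplectic`; the conclusion of Step 3 of the proof of `SW(K⁻¹) = ±1`
(Hutchings–Taubes (1999) §4.5, Taubes (1995) Theorem 1.3 Step 3 / Taubes (1994) Main Theorem,
uniqueness part) for the tree's family: every solution `(A, ψ = αu₀ + β)` of the Seiberg–Witten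
equations of `𝔰_J` with perturbation `P₊F_{A₀} - (r/4)s`, `r = |c|²`, satisfies, once
`r > 16·sup_N |b|²` (`b` Taubes's torsion = the Nijenhuis tensor),

  `β ≡ 0`, `|α|² ≡ r`, `∇'α ≡ 0` (`∇' = d + ia`, `a = ½(A - A₀)`)

(`betaSq_eq_zero_of_isSolution`, `alphaSq_eq_of_isSolution`, `connDeriv_alphaFun_eq_zero_of_isSolution`):
the configuration is `(A₀ + 2a, αu₀)` with `α` of constant modulus `√r`, covariantly constant for
`d + ia` — i.e. gauge equivalent to Taubes's `(A₀, √r u₀)`.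

Proof ("(4.16)–(4.19)"): adding the "auspicious square" identity (`TaubesFamilyAlphaEnergy`)
`∫(Σ_k|∇'_kα|² - |∂̄'α|² + ¼(|α|²-r)² - ¼|β|²(|α|²-r)) = 0` and the cross-term identity
(`TaubesFamilyCrossTerm`, with `|D_Aβ|² = |∂̄'α|²` from `TaubesFamilyDiracBetaEnergy`)
`∫(|∂̄'α|² + ½|α|²|β|² - 2Σ_k Re(θ_k b_k β̄)) = 0` gives

  `∫ (Σ_k|∇'_kα|² + ¼(|α|²-r)² + ¼|α|²|β|² + (r/4)|β|² - 2Σ_k Re(θ_k b_k β̄))(s∧s) = 0`,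

and `2Σ_k Re(θ_k b_k β̄) ≤ (r/4)|β|² + (16/r)|b|²Σ_k|θ_k|²` pointwise; so the non-negative smooth top
form `((1 - 16T²/r)Σ_k|∇'_kα|² + ¼(|α|²-r)² + ¼|α|²|β|²)(s∧s)`, `T² = sup|b|²`, has non-positive
integral, hence vanishes identically.

PROVED, 0 named facts.

## References

* M. Hutchings, C. H. Taubes, *An introduction to the Seiberg–Witten equations on symplectic
  manifolds*, IAS/Park City Math. Ser. 7 (1999; AMS 2006), §4.5 (4.16)–(4.19). [HutchingsTaubes2006]
* C. H. Taubes, *The Seiberg–Witten and Gromov invariants*, Math. Res. Lett. 2 (1995) 221–238,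
  §5 Step 3. [Taubes1995]
* C. H. Taubes, *The Seiberg–Witten invariants and symplectic forms*, Math. Res. Lett. 1 (1994)
  809–822, §3 (20)–(21). [Taubes1994]
-/

noncomputable section

open scoped Manifold ContDiff Topology ComplexConjugate Matrix
open Set Function Filter Complex Literature.Geometry.Kaehler Literature.Geometry.GaugeTheory Literature.Topology.FourManifolds
open Literature.Geometry.Lorentzian (PseudoRiemannianMetric)
open Literature.Geometry.Manifold Literature.Geometry.Manifold.DeRhamSignFour Literature.NumberTheory.Transcendental

namespace Literature.Geometry.Symplectic

open Literature.Geometry.GaugeTheory.SpincStructure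

/-! ### A non-negative function with a smooth, zero-integral top form vanishes -/

section Integral

variable {N : Type} [TopologicalSpace N] [ChartedSpace (EuclideanSpace ℝ (Fin 4)) N] [T2Space N] [CompactSpace N]
  [IsManifold (𝓡 4) ∞ N] {v : MForm (𝓡 4) N ℝ 4} (hv : IsSmoothForm v) (hne : ∀ x, v x ≠ 0)

include hv in
/-- **`f ≥ 0`, `f·v` smooth and `∫ f·v = 0` force `f ≡ 0`** (`v` nowhere zero; Lee 2013, Prop. 16.6(c)
contraposed). [cite: LeeSmoothManifolds2013, Prop. 16.6] -/
theorem eq_zero_of_integral_fun_smul_eq_zero {f : N → ℝ} (hf : ∀ x, 0 ≤ f x) (hfs : IsSmoothForm (f • v))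
    (h0 : MForm.integral (rayFamily hne) (f • v) = 0) (x : N) : f x = 0 := by
  by_contra hx
  have hpos : 0 < f x := lt_of_le_of_ne (hf x) (Ne.symm hx)
  have h1 : ∀ y, (show (EuclideanSpace ℝ (Fin 4)) [⋀^Fin 4]→L[ℝ] ℝ from (f • v) y) (modelBasis (EuclideanSpace ℝ (Fin 4)) 4) =
      f y * (show (EuclideanSpace ℝ (Fin 4)) [⋀^Fin 4]→L[ℝ] ℝ from v y) (modelBasis (EuclideanSpace ℝ (Fin 4)) 4) := fun y ↦ rfl
  have hv0 : ∀ y, 0 ≤ Real.sign (orientationForm (rayFamily hne) y (modelBasis (EuclideanSpace ℝ (Fin 4)) 4)) *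
      (show (EuclideanSpace ℝ (Fin 4)) [⋀^Fin 4]→L[ℝ] ℝ from v y) (modelBasis (EuclideanSpace ℝ (Fin 4)) 4) := by
    intro y
    have hy := abs_nonneg (v y ⇑(modelBasis (EuclideanSpace ℝ (Fin 4)) 4))
    rw [← real_sign_mul_self, ← sign_orientationForm_rayFamily hne y] at hy
    exact hy
  have hvx : 0 < Real.sign (orientationForm (rayFamily hne) x (modelBasis (EuclideanSpace ℝ (Fin 4)) 4)) *
      (show (EuclideanSpace ℝ (Fin 4)) [⋀^Fin 4]→L[ℝ] ℝ from v x) (modelBasis (EuclideanSpace ℝ (Fin 4)) 4) := by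
    have hc : v x ⇑(modelBasis (EuclideanSpace ℝ (Fin 4)) 4) ≠ 0 := fun h ↦ hne x <| by
      have h2 : (v x).toAlternatingMap = 0 :=
        (AlternatingMap.map_basis_eq_zero_iff (modelBasis (EuclideanSpace ℝ (Fin 4)) 4) (v x).toAlternatingMap).1 h
      exact ContinuousAlternatingMap.toAlternatingMap_injective (h2.trans ContinuousAlternatingMap.toAlternatingMap_zero.symm)
    have hy := abs_pos.2 hc
    rw [← real_sign_mul_self, ← sign_orientationForm_rayFamily hne x] at hy
    exact hy
  have hI := MForm.integral_pos_of_sign_mul_apply_nonneg (isContinuousOrientation_rayFamily hv hne) hfs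
    (fun y ↦ by rw [h1 y, mul_left_comm]; exact mul_nonneg (hf y) (hv0 y))
    ⟨x, by rw [h1 x, mul_left_comm]; exact mul_pos hpos hvx⟩
  exact hI.ne' h0

end Integral

namespace AlmostComplexStructure.IsCompatibleWith

variable {N : Type} [TopologicalSpace N] [ChartedSpace (EuclideanSpace ℝ (Fin 4)) N] [IsManifold (𝓡 4) ∞ N]
  {J : AlmostComplexStructure (𝓡 4) ∞ N} {s : MForm (𝓡 4) N ℝ 2}
  (h : J.IsCompatibleWith s) (hs : IsSmoothForm s)
  (hnd : ∀ x (v : TangentSpace (𝓡 4) x), v ≠ 0 → ∃ w : TangentSpace (𝓡 4) x, s x ![v, w] ≠ 0)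

/-! ### The torsion is bounded: `|b|² = |∇̃^{A₀}u₀|²` -/

/-- **`Σ_k |b(e_k)|² = |∇̃^{A₀}u₀|²`** in the chart (`∇̃^{A₀}u₀ = b ⊗ u₁`, `|u₁| = 1`). [cite: Taubes1994, §1 (1)] -/
theorem sum_normSq_canonicalTorsion_eq [(h.metric hs).HasLeviCivita] (i x : N) :
    ∑ k, Complex.normSq ((h.unitaryAdaptedFrames hs hnd).canonicalTorsion i x ((h.canonicalSpincStructure hs hnd).frame i k x)) =
      (h.canonicalSpincStructure hs hnd).gradNormSqChart (h.taubesConnection hs hnd) (h.canonicalSpinor hs hnd) i x := by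
  unfold SpincStructure.gradNormSqChart
  refine Finset.sum_congr rfl fun k _ ↦ ?_
  rw [h.covDeriv_taubesConnection_canonicalSpinor hs hnd, spinorHermNormSq, Fintype.sum_sum_type, Fin.sum_univ_two, Fin.sum_univ_two]
  simp [detUnit]

/-- **`sup_N |b|² < ∞`**: the torsion norm `x ↦ Σ_k|b(e_k)|²` (chart at the point) is bounded on the
closed manifold (it is the smooth function `|∇̃^{A₀}u₀|²`). [cite: Taubes1994, §3 (p. 817)] -/
theorem bddAbove_range_sum_normSq_canonicalTorsion [CompactSpace N] [(h.metric hs).HasLeviCivita] :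
    BddAbove (range fun x : N ↦ ∑ k, Complex.normSq ((h.unitaryAdaptedFrames hs hnd).canonicalTorsion
      ((h.canonicalSpincStructure hs hnd).indexAt x) x
        ((h.canonicalSpincStructure hs hnd).frame ((h.canonicalSpincStructure hs hnd).indexAt x) k x))) := by
  have hc : Continuous fun x : N ↦ (h.canonicalSpincStructure hs hnd).gradNormSqChart (h.taubesConnection hs hnd)
      (h.canonicalSpinor hs hnd) ((h.canonicalSpincStructure hs hnd).indexAt x) x :=
    ((h.canonicalSpincStructure hs hnd).contMDiff_gradNormSqChart_indexAt (h.taubesConnection hs hnd)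
      (h.isSmooth_canonicalSpinor hs hnd)).continuous
  simp only [h.sum_normSq_canonicalTorsion_eq hs hnd]
  exact (isCompact_range hc).bddAbove

/-! ### The pointwise Cauchy–Schwarz/AM–GM bound on the cross term -/

/-- `2 Re(θ b β̄) ≤ (r/16)|β|² + (16/r)|θ|²|b|²` for `r > 0`. [folklore] -/
theorem two_mul_re_le (θ b β : ℂ) {r : ℝ} (hr : 0 < r) :
    2 * (θ * b * conj β).re ≤ r / 16 * Complex.normSq β + 16 / r * (Complex.normSq θ * Complex.normSq b) := by
  have h1 : (θ * b * conj β).re ≤ ‖θ * b * conj β‖ := Complex.re_le_norm _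
  rw [norm_mul, norm_mul, Complex.norm_conj] at h1
  have hn : ∀ z : ℂ, Complex.normSq z = ‖z‖ ^ 2 := fun z ↦ (Complex.sq_norm z).symm
  rw [hn, hn, hn]
  have h0 := norm_nonneg θ
  have hb := norm_nonneg b
  have hβ := norm_nonneg β
  -- `2xy ≤ (r/16)x² + (16/r)y²` with `x = ‖β‖`, `y = ‖θ‖‖b‖`
  have key : 2 * (‖θ‖ * ‖b‖ * ‖β‖) ≤ r / 16 * ‖β‖ ^ 2 + 16 / r * (‖θ‖ ^ 2 * ‖b‖ ^ 2) := by
    have hsq : 0 ≤ r / 16 * (‖β‖ - 16 / r * (‖θ‖ * ‖b‖)) ^ 2 := by positivity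
    have hexp : r / 16 * (‖β‖ - 16 / r * (‖θ‖ * ‖b‖)) ^ 2 =
        r / 16 * ‖β‖ ^ 2 - 2 * (‖θ‖ * ‖b‖ * ‖β‖) + 16 / r * (‖θ‖ ^ 2 * ‖b‖ ^ 2) := by
      field_simp
      ring
    linarith
  linarith

/-- **`2Σ_k Re(θ_k b_k β̄) ≤ (r/4)|β|² + (16/r)(Σ_k|θ_k|²)(Σ_k|b_k|²)`.** [cite: HutchingsTaubes2006, §4.5 (4.16)] -/
theorem two_mul_sum_re_le (θ b : Fin 4 → ℂ) (β : ℂ) {r : ℝ} (hr : 0 < r) :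
    2 * ∑ k, (θ k * b k * conj β).re ≤
      r / 4 * Complex.normSq β + 16 / r * ((∑ k, Complex.normSq (θ k)) * ∑ k, Complex.normSq (b k)) := by
  have hk : ∀ k, 2 * (θ k * b k * conj β).re ≤ r / 16 * Complex.normSq β + 16 / r * (Complex.normSq (θ k) * ∑ l, Complex.normSq (b l)) := by
    intro k
    refine (two_mul_re_le (θ k) (b k) β hr).trans ?_
    have hle : Complex.normSq (b k) ≤ ∑ l, Complex.normSq (b l) :=
      Finset.single_le_sum (fun l _ ↦ Complex.normSq_nonneg (b l)) (Finset.mem_univ k)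
    have h16 : 0 ≤ 16 / r := by positivity
    nlinarith [Complex.normSq_nonneg (θ k), mul_le_mul_of_nonneg_left hle (Complex.normSq_nonneg (θ k))]
  rw [Finset.mul_sum, Fin.sum_univ_four, Fin.sum_univ_four]
  have := hk 0; have := hk 1; have := hk 2; have := hk 3
  nlinarith

/-! ### The total identity `∫(Σ|∇'α|² + ¼(|α|²-r)² + ¼|α|²|β|² + (r/4)|β|² - 2ΣRe(θ b β̄)) = 0` -/

section Total

variable [T2Space N] [CompactSpace N] [(h.metric hs).HasLeviCivita]

omit [T2Space N] [CompactSpace N] in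
/-- The cross-term integrand is smooth (it is a sum of three divergences). [folklore] -/
theorem contMDiff_crossTerm_integrand (hcl : IsClosedForm s) (c : ℂ) {cfg : (h.canonicalSpincStructure hs hnd).Configuration}
    (hsol : SpincStructure.IsSolution (h.taubesPerturbation hs hnd - h.symplecticPerturbation hs hnd (Complex.normSq c / 4)) cfg) :
    ContMDiff (𝓡 4) 𝓘(ℝ, ℝ) ∞ (fun x ↦
      (spinorHermNormSq (dirac cfg.conn (h.betaField hs hnd cfg) ((h.canonicalSpincStructure hs hnd).indexAt x) x) +
          2⁻¹ * Complex.normSq (h.alphaFun hs hnd cfg x) * h.betaSq hs hnd cfg x -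
          2 * ∑ k, (connDeriv (h.alphaFun hs hnd cfg) (h.halfConnectionDiff hs hnd cfg) x ((h.canonicalSpincStructure hs hnd).frame ((h.canonicalSpincStructure hs hnd).indexAt x) k x) * (h.unitaryAdaptedFrames hs hnd).canonicalTorsion ((h.canonicalSpincStructure hs hnd).indexAt x) x ((h.canonicalSpincStructure hs hnd).frame ((h.canonicalSpincStructure hs hnd).indexAt x) k x) * conj (cfg.plusSpinor ((h.canonicalSpincStructure hs hnd).indexAt x) x 0)).re)) := by
  have hαu : (h.alphaFun hs hnd cfg • h.canonicalSpinor hs hnd).IsSmooth :=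
    (h.isSmooth_canonicalSpinor hs hnd).smulFun (h.contMDiff_alphaFun hs hnd cfg)
  have hβ := h.isSmooth_betaField hs hnd cfg
  have hcβ : ((fun y ↦ conj (h.alphaFun hs hnd cfg y)) • h.betaField hs hnd cfg).IsSmooth :=
    hβ.smulFun ((Complex.conjCLE : ℂ ≃L[ℝ] ℂ).contDiff.comp_contMDiff (h.contMDiff_alphaFun hs hnd cfg))
  have hΦ := (h.canonicalSpincStructure hs hnd).isSmooth_diracField cfg.conn hαu
  have hu := h.isSmooth_canonicalSpinor hs hnd
  have hs₁ := h.contMDiff_divergence hs hnd (θ := (h.canonicalSpincStructure hs hnd).cliffordPairingForm ((h.canonicalSpincStructure hs hnd).diracField cfg.conn hαu) (h.betaField hs hnd cfg))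
    fun x ↦ (h.canonicalSpincStructure hs hnd).smoothAt_cliffordPairingForm hΦ hβ x
  have hs₂ := h.contMDiff_divergence hs hnd (θ := (h.canonicalSpincStructure hs hnd).covDerivPairingForm cfg.conn (h.alphaFun hs hnd cfg • h.canonicalSpinor hs hnd) (h.betaField hs hnd cfg))
    fun x ↦ (h.canonicalSpincStructure hs hnd).smoothAt_covDerivPairingForm cfg.conn hαu hβ x
  have hs₃ := h.contMDiff_divergence hs hnd (θ := (h.canonicalSpincStructure hs hnd).covDerivPairingForm (h.taubesConnection hs hnd) (h.canonicalSpinor hs hnd)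
      ((fun y ↦ conj (h.alphaFun hs hnd cfg y)) • h.betaField hs hnd cfg))
    fun x ↦ (h.canonicalSpincStructure hs hnd).smoothAt_covDerivPairingForm (h.taubesConnection hs hnd) hu hcβ x
  refine ((hs₁.add hs₂).sub hs₃).congr fun x ↦ ?_
  have hi := (h.canonicalSpincStructure hs hnd).mem_baseSet_indexAt x
  rw [h.divergence_cliffordPairingForm_eq hs hnd cfg.conn hΦ hβ, h.divergence_covDerivPairingForm_eq hs hnd cfg.conn hαu hβ,
    h.divergence_covDerivPairingForm_eq hs hnd (h.taubesConnection hs hnd) hu hcβ]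
  exact h.crossTerm_integrand_eq hs hnd hcl c hsol _ hi

/-- **The total integral identity of Step 3**: for a solution of the family,
`∫_N (Σ_k|∇'_kα|² + ¼(|α|² - r)² + ¼|α|²|β|² + (r/4)|β|² - 2Σ_k Re(θ_k b_k β̄))(s ∧ s) = 0` — the sum
of the "auspicious square" identity and the cross-term identity (`|D_Aβ|² = |∂̄'α|²`).
[cite: HutchingsTaubes2006, §4.5 (4.15)–(4.19)] -/
theorem integral_total_eq_zero (hcl : IsClosedForm s) (c : ℂ) {cfg : (h.canonicalSpincStructure hs hnd).Configuration}
    (hsol : SpincStructure.IsSolution (h.taubesPerturbation hs hnd - h.symplecticPerturbation hs hnd (Complex.normSq c / 4)) cfg) :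
    IsSmoothForm ((fun x ↦ ((∑ k, Complex.normSq (connDeriv (h.alphaFun hs hnd cfg) (h.halfConnectionDiff hs hnd cfg) x ((h.canonicalSpincStructure hs hnd).frame ((h.canonicalSpincStructure hs hnd).indexAt x) k x))) +
          4⁻¹ * (h.alphaSq hs hnd cfg x - Complex.normSq c) ^ 2 +
          4⁻¹ * h.alphaSq hs hnd cfg x * h.betaSq hs hnd cfg x +
          Complex.normSq c / 4 * h.betaSq hs hnd cfg x -
          2 * ∑ k, (connDeriv (h.alphaFun hs hnd cfg) (h.halfConnectionDiff hs hnd cfg) x ((h.canonicalSpincStructure hs hnd).frame ((h.canonicalSpincStructure hs hnd).indexAt x) k x) * (h.unitaryAdaptedFrames hs hnd).canonicalTorsion ((h.canonicalSpincStructure hs hnd).indexAt x) x ((h.canonicalSpincStructure hs hnd).frame ((h.canonicalSpincStructure hs hnd).indexAt x) k x) * conj (cfg.plusSpinor ((h.canonicalSpincStructure hs hnd).indexAt x) x 0)).re)) • (s.wedge s).castDeg two_add_two_eq_four) ∧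
    MForm.integral (rayFamily (wedge_self_castDeg_apply_ne_zero s hnd))
      ((fun x ↦ ((∑ k, Complex.normSq (connDeriv (h.alphaFun hs hnd cfg) (h.halfConnectionDiff hs hnd cfg) x ((h.canonicalSpincStructure hs hnd).frame ((h.canonicalSpincStructure hs hnd).indexAt x) k x))) +
          4⁻¹ * (h.alphaSq hs hnd cfg x - Complex.normSq c) ^ 2 +
          4⁻¹ * h.alphaSq hs hnd cfg x * h.betaSq hs hnd cfg x +
          Complex.normSq c / 4 * h.betaSq hs hnd cfg x -
          2 * ∑ k, (connDeriv (h.alphaFun hs hnd cfg) (h.halfConnectionDiff hs hnd cfg) x ((h.canonicalSpincStructure hs hnd).frame ((h.canonicalSpincStructure hs hnd).indexAt x) k x) * (h.unitaryAdaptedFrames hs hnd).canonicalTorsion ((h.canonicalSpincStructure hs hnd).indexAt x) x ((h.canonicalSpincStructure hs hnd).frame ((h.canonicalSpincStructure hs hnd).indexAt x) k x) * conj (cfg.plusSpinor ((h.canonicalSpincStructure hs hnd).indexAt x) x 0)).re)) • (s.wedge s).castDeg two_add_two_eq_four) = 0 := by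
  have hv : IsSmoothForm ((s.wedge s).castDeg two_add_two_eq_four) := (wedge_self_castDeg_mem_closedSmoothForms ⟨hs, hcl⟩).1
  have hne := wedge_self_castDeg_apply_ne_zero s hnd
  have hFs : IsSmoothForm ((fun x ↦ ((∑ k, Complex.normSq (connDeriv (h.alphaFun hs hnd cfg) (h.halfConnectionDiff hs hnd cfg) x ((h.canonicalSpincStructure hs hnd).frame ((h.canonicalSpincStructure hs hnd).indexAt x) k x))) -
          (Complex.normSq (connDeriv (h.alphaFun hs hnd cfg) (h.halfConnectionDiff hs hnd cfg) x ((h.canonicalSpincStructure hs hnd).frame ((h.canonicalSpincStructure hs hnd).indexAt x) 0 x) + I * connDeriv (h.alphaFun hs hnd cfg) (h.halfConnectionDiff hs hnd cfg) x ((h.canonicalSpincStructure hs hnd).frame ((h.canonicalSpincStructure hs hnd).indexAt x) 1 x)) + Complex.normSq (connDeriv (h.alphaFun hs hnd cfg) (h.halfConnectionDiff hs hnd cfg) x ((h.canonicalSpincStructure hs hnd).frame ((h.canonicalSpincStructure hs hnd).indexAt x) 2 x) + I * connDeriv (h.alphaFun hs hnd cfg) (h.halfConnectionDiff hs hnd cfg)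 x ((h.canonicalSpincStructure hs hnd).frame ((h.canonicalSpincStructure hs hnd).indexAt x) 3 x))) +
          4⁻¹ * (h.alphaSq hs hnd cfg x - Complex.normSq c) ^ 2 -
          4⁻¹ * h.betaSq hs hnd cfg x * (h.alphaSq hs hnd cfg x - Complex.normSq c))) • (s.wedge s).castDeg two_add_two_eq_four) :=
    (exactSmoothForms_le_closedSmoothForms (inChart_mextDeriv_holds (𝓡 4) N ℝ) (h.bogomolnyForm_mem_exactSmoothForms hs hnd hcl c hsol)).1
  have hF0 := h.integral_bogomolny_alpha_eq_zero hs hnd hcl c hsol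
  have hGs : IsSmoothForm ((fun x ↦ (spinorHermNormSq (dirac cfg.conn (h.betaField hs hnd cfg) ((h.canonicalSpincStructure hs hnd).indexAt x) x) +
          2⁻¹ * Complex.normSq (h.alphaFun hs hnd cfg x) * h.betaSq hs hnd cfg x -
          2 * ∑ k, (connDeriv (h.alphaFun hs hnd cfg) (h.halfConnectionDiff hs hnd cfg) x ((h.canonicalSpincStructure hs hnd).frame ((h.canonicalSpincStructure hs hnd).indexAt x) k x) * (h.unitaryAdaptedFrames hs hnd).canonicalTorsion ((h.canonicalSpincStructure hs hnd).indexAt x) x ((h.canonicalSpincStructure hs hnd).frame ((h.canonicalSpincStructure hs hnd).indexAt x) k x) * conj (cfg.plusSpinor ((h.canonicalSpincStructure hs hnd).indexAt x) x 0)).re)) • (s.wedge s).castDeg two_add_two_eq_four) :=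
    isSmoothForm_fun_smul hv (h.contMDiff_crossTerm_integrand hs hnd hcl c hsol)
  have hG0 := h.integral_crossTerm_eq_zero hs hnd hcl c hsol
  -- `|D_Aβ|² = |∂̄'α|²` and the pointwise sum
  have hP : ∀ x, spinorHermNormSq (dirac cfg.conn (h.betaField hs hnd cfg) ((h.canonicalSpincStructure hs hnd).indexAt x) x) = (Complex.normSq (connDeriv (h.alphaFun hs hnd cfg) (h.halfConnectionDiff hs hnd cfg) x ((h.canonicalSpincStructure hs hnd).frame ((h.canonicalSpincStructure hs hnd).indexAt x) 0 x) + I * connDeriv (h.alphaFun hs hnd cfg) (h.halfConnectionDiff hs hnd cfg) x ((h.canonicalSpincStructure hs hnd).frame ((h.canonicalSpincStructure hs hnd).indexAt x) 1 x)) + Complex.normSq (connDeriv (h.alphaFun hs hnd cfg) (h.halfConnectionDiff hs hnd cfg) x ((h.canonicalSpincStructure hs hnd).frame ((h.canonicalSpincStructure hs hnd).indexAt x) 2 x) + I * connDeriv (h.alphaFun hs hnd cfg) (h.halfConnectionDiff hs hnd cfg) x ((h.canonicalSpincStructure hs hnd).frame ((h.canonicalSpincStructure hs hnd).indexAt x)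 3 x))) := fun x ↦
    h.hermNormSq_diracField_betaField_eq hs hnd hcl hsol x
  have heq : ((fun x ↦ ((∑ k, Complex.normSq (connDeriv (h.alphaFun hs hnd cfg) (h.halfConnectionDiff hs hnd cfg) x ((h.canonicalSpincStructure hs hnd).frame ((h.canonicalSpincStructure hs hnd).indexAt x) k x))) +
          4⁻¹ * (h.alphaSq hs hnd cfg x - Complex.normSq c) ^ 2 +
          4⁻¹ * h.alphaSq hs hnd cfg x * h.betaSq hs hnd cfg x +
          Complex.normSq c / 4 * h.betaSq hs hnd cfg x -
          2 * ∑ k, (connDeriv (h.alphaFun hs hnd cfg) (h.halfConnectionDiff hs hnd cfg) x ((h.canonicalSpincStructure hs hnd).frame ((h.canonicalSpincStructure hs hnd).indexAt x) k x) * (h.unitaryAdaptedFrames hs hnd).canonicalTorsion ((h.canonicalSpincStructure hs hnd).indexAt x) x ((h.canonicalSpincStructure hs hnd).frame ((h.canonicalSpincStructure hs hnd).indexAt x) k x) * conj (cfg.plusSpinor ((h.canonicalSpincStructure hs hnd).indexAt x) x 0)).re)) • (s.wedge s).castDeg two_add_two_eq_four : MForm (𝓡 4) N ℝ 4) =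
      (fun x ↦ ((∑ k, Complex.normSq (connDeriv (h.alphaFun hs hnd cfg) (h.halfConnectionDiff hs hnd cfg) x ((h.canonicalSpincStructure hs hnd).frame ((h.canonicalSpincStructure hs hnd).indexAt x) k x))) -
          (Complex.normSq (connDeriv (h.alphaFun hs hnd cfg) (h.halfConnectionDiff hs hnd cfg) x ((h.canonicalSpincStructure hs hnd).frame ((h.canonicalSpincStructure hs hnd).indexAt x) 0 x) + I * connDeriv (h.alphaFun hs hnd cfg) (h.halfConnectionDiff hs hnd cfg) x ((h.canonicalSpincStructure hs hnd).frame ((h.canonicalSpincStructure hs hnd).indexAt x) 1 x)) + Complex.normSq (connDeriv (h.alphaFun hs hnd cfg) (h.halfConnectionDiff hs hnd cfg) x ((h.canonicalSpincStructure hs hnd).frame ((h.canonicalSpincStructure hs hnd).indexAt x) 2 x) + I * connDeriv (h.alphaFun hs hnd cfg) (h.halfConnectionDiff hs hnd cfg) x ((h.canonicalSpincStructure hs hnd).frame ((h.canonicalSpincStructure hs hnd).indexAt x) 3 x))) +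
          4⁻¹ * (h.alphaSq hs hnd cfg x - Complex.normSq c) ^ 2 -
          4⁻¹ * h.betaSq hs hnd cfg x * (h.alphaSq hs hnd cfg x - Complex.normSq c))) • (s.wedge s).castDeg two_add_two_eq_four +
        (fun x ↦ (spinorHermNormSq (dirac cfg.conn (h.betaField hs hnd cfg) ((h.canonicalSpincStructure hs hnd).indexAt x) x) +
          2⁻¹ * Complex.normSq (h.alphaFun hs hnd cfg x) * h.betaSq hs hnd cfg x -
          2 * ∑ k, (connDeriv (h.alphaFun hs hnd cfg) (h.halfConnectionDiff hs hnd cfg) x ((h.canonicalSpincStructure hs hnd).frame ((h.canonicalSpincStructure hs hnd).indexAt x) k x) * (h.unitaryAdaptedFrames hs hnd).canonicalTorsion ((h.canonicalSpincStructure hs hnd).indexAt x) x ((h.canonicalSpincStructure hs hnd).frame ((h.canonicalSpincStructure hs hnd).indexAt x) k x) * conj (cfg.plusSpinor ((h.canonicalSpincStructure hs hnd).indexAt x) x 0)).re)) • (s.wedge s).castDeg two_add_two_eq_four := by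
    have hG' : (fun x ↦ (spinorHermNormSq (dirac cfg.conn (h.betaField hs hnd cfg) ((h.canonicalSpincStructure hs hnd).indexAt x) x) +
          2⁻¹ * Complex.normSq (h.alphaFun hs hnd cfg x) * h.betaSq hs hnd cfg x -
          2 * ∑ k, (connDeriv (h.alphaFun hs hnd cfg) (h.halfConnectionDiff hs hnd cfg) x ((h.canonicalSpincStructure hs hnd).frame ((h.canonicalSpincStructure hs hnd).indexAt x) k x) * (h.unitaryAdaptedFrames hs hnd).canonicalTorsion ((h.canonicalSpincStructure hs hnd).indexAt x) x ((h.canonicalSpincStructure hs hnd).frame ((h.canonicalSpincStructure hs hnd).indexAt x) k x) * conj (cfg.plusSpinor ((h.canonicalSpincStructure hs hnd).indexAt x) x 0)).re)) =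
        fun x ↦ ((Complex.normSq (connDeriv (h.alphaFun hs hnd cfg) (h.halfConnectionDiff hs hnd cfg) x ((h.canonicalSpincStructure hs hnd).frame ((h.canonicalSpincStructure hs hnd).indexAt x) 0 x) + I * connDeriv (h.alphaFun hs hnd cfg) (h.halfConnectionDiff hs hnd cfg) x ((h.canonicalSpincStructure hs hnd).frame ((h.canonicalSpincStructure hs hnd).indexAt x) 1 x)) + Complex.normSq (connDeriv (h.alphaFun hs hnd cfg) (h.halfConnectionDiff hs hnd cfg) x ((h.canonicalSpincStructure hs hnd).frame ((h.canonicalSpincStructure hs hnd).indexAt x) 2 x) + I * connDeriv (h.alphaFun hs hnd cfg) (h.halfConnectionDiff hs hnd cfg) x ((h.canonicalSpincStructure hs hnd).frame ((h.canonicalSpincStructure hs hnd).indexAt x) 3 x))) +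
          2⁻¹ * h.alphaSq hs hnd cfg x * h.betaSq hs hnd cfg x -
          2 * ∑ k, (connDeriv (h.alphaFun hs hnd cfg) (h.halfConnectionDiff hs hnd cfg) x ((h.canonicalSpincStructure hs hnd).frame ((h.canonicalSpincStructure hs hnd).indexAt x) k x) * (h.unitaryAdaptedFrames hs hnd).canonicalTorsion ((h.canonicalSpincStructure hs hnd).indexAt x) x ((h.canonicalSpincStructure hs hnd).frame ((h.canonicalSpincStructure hs hnd).indexAt x) k x) * conj (cfg.plusSpinor ((h.canonicalSpincStructure hs hnd).indexAt x) x 0)).re) := by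
      funext x
      rw [hP x, h.normSq_alphaFun hs hnd cfg x]
    rw [hG']
    funext x
    ext w
    simp
    ring
  refine ⟨heq ▸ hFs.add hGs, ?_⟩
  rw [heq, MForm.integral_add_holds _ (isContinuousOrientation_rayFamily hv hne) hFs hGs, hF0, hG0, add_zero]

end Total

/-! ### Uniqueness for large `r` -/

/-- **Hutchings–Taubes (4.19) ⇒ uniqueness: `∇'α ≡ 0`, `|α|² ≡ r`, `β ≡ 0`** for every solution
`(A, ψ = αu₀ + β)` of `(SW)` with perturbation `P₊F_{A₀} - (r/4)s` once `r = |c|² > 16 sup_N|b|²`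
(`b` Taubes's torsion): the solution is `(A₀ + 2a, αu₀)` with `|α| = √r` constant and `(d + ia)α = 0`,
i.e. Taubes's solution up to gauge. [cite: HutchingsTaubes2006, §4.5 (4.19)] [cite: Taubes1995, Thm. 1.3, §5 Step 3]
[cite: Taubes1994, §3 (20)–(21)] -/
theorem eq_taubes_of_isSolution [T2Space N] [CompactSpace N] [(h.metric hs).HasLeviCivita]
    (hcl : IsClosedForm s) (c : ℂ) {cfg : (h.canonicalSpincStructure hs hnd).Configuration}
    (hsol : SpincStructure.IsSolution (h.taubesPerturbation hs hnd - h.symplecticPerturbation hs hnd (Complex.normSq c / 4)) cfg)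
    (hr : 16 * (⨆ y : N, ∑ k, Complex.normSq ((h.unitaryAdaptedFrames hs hnd).canonicalTorsion ((h.canonicalSpincStructure hs hnd).indexAt y) y ((h.canonicalSpincStructure hs hnd).frame ((h.canonicalSpincStructure hs hnd).indexAt y) k y))) < Complex.normSq c) (x : N) :
    (∀ k, connDeriv (h.alphaFun hs hnd cfg) (h.halfConnectionDiff hs hnd cfg) x ((h.canonicalSpincStructure hs hnd).frame ((h.canonicalSpincStructure hs hnd).indexAt x) k x) = 0) ∧ h.alphaSq hs hnd cfg x = Complex.normSq c ∧ h.betaSq hs hnd cfg x = 0 := by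
  have hv : IsSmoothForm ((s.wedge s).castDeg two_add_two_eq_four) := (wedge_self_castDeg_mem_closedSmoothForms ⟨hs, hcl⟩).1
  have hne := wedge_self_castDeg_apply_ne_zero s hnd
  obtain ⟨hHs, hH0⟩ := h.integral_total_eq_zero hs hnd hcl c hsol
  have hbdd := h.bddAbove_range_sum_normSq_canonicalTorsion hs hnd
  have hT0 : 0 ≤ (⨆ y : N, ∑ k, Complex.normSq ((h.unitaryAdaptedFrames hs hnd).canonicalTorsion ((h.canonicalSpincStructure hs hnd).indexAt y) y ((h.canonicalSpincStructure hs hnd).frame ((h.canonicalSpincStructure hs hnd).indexAt y) k y))) :=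
    (Finset.sum_nonneg fun k _ ↦ Complex.normSq_nonneg _).trans (le_ciSup hbdd x)
  have hr0 : 0 < Complex.normSq c := by nlinarith
  -- the integrand is pointwise `≥ (1 - 16T²/r)Σ|θ|² + ¼(|α|²-r)² + ¼|α|²|β|² ≥ 0`
  have hlow : ∀ y : N,
      (1 - 16 * (⨆ y : N, ∑ k, Complex.normSq ((h.unitaryAdaptedFrames hs hnd).canonicalTorsion ((h.canonicalSpincStructure hs hnd).indexAt y) y ((h.canonicalSpincStructure hs hnd).frame ((h.canonicalSpincStructure hs hnd).indexAt y) k y))) / Complex.normSq c) * (∑ k, Complex.normSq (connDeriv (h.alphaFun hs hnd cfg) (h.halfConnectionDiff hs hnd cfg) y ((h.canonicalSpincStructure hs hnd).frame ((h.canonicalSpincStructure hs hnd).indexAt y) k y))) +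
        4⁻¹ * (h.alphaSq hs hnd cfg y - Complex.normSq c) ^ 2 + 4⁻¹ * h.alphaSq hs hnd cfg y * h.betaSq hs hnd cfg y ≤
      ((∑ k, Complex.normSq (connDeriv (h.alphaFun hs hnd cfg) (h.halfConnectionDiff hs hnd cfg) y ((h.canonicalSpincStructure hs hnd).frame ((h.canonicalSpincStructure hs hnd).indexAt y) k y))) +
          4⁻¹ * (h.alphaSq hs hnd cfg y - Complex.normSq c) ^ 2 +
          4⁻¹ * h.alphaSq hs hnd cfg y * h.betaSq hs hnd cfg y +
          Complex.normSq c / 4 * h.betaSq hs hnd cfg y -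
          2 * ∑ k, (connDeriv (h.alphaFun hs hnd cfg) (h.halfConnectionDiff hs hnd cfg) y ((h.canonicalSpincStructure hs hnd).frame ((h.canonicalSpincStructure hs hnd).indexAt y) k y) * (h.unitaryAdaptedFrames hs hnd).canonicalTorsion ((h.canonicalSpincStructure hs hnd).indexAt y) y ((h.canonicalSpincStructure hs hnd).frame ((h.canonicalSpincStructure hs hnd).indexAt y) k y) * conj (cfg.plusSpinor ((h.canonicalSpincStructure hs hnd).indexAt y) y 0)).re) := by
    intro y
    have hcs := two_mul_sum_re_le (fun k ↦ connDeriv (h.alphaFun hs hnd cfg) (h.halfConnectionDiff hs hnd cfg) y ((h.canonicalSpincStructure hs hnd).frame ((h.canonicalSpincStructure hs hnd).indexAt y) k y))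
      (fun k ↦ (h.unitaryAdaptedFrames hs hnd).canonicalTorsion ((h.canonicalSpincStructure hs hnd).indexAt y) y ((h.canonicalSpincStructure hs hnd).frame ((h.canonicalSpincStructure hs hnd).indexAt y) k y)) (cfg.plusSpinor ((h.canonicalSpincStructure hs hnd).indexAt y) y 0) hr0
    have hτ : ∑ k, Complex.normSq ((h.unitaryAdaptedFrames hs hnd).canonicalTorsion ((h.canonicalSpincStructure hs hnd).indexAt y) y ((h.canonicalSpincStructure hs hnd).frame ((h.canonicalSpincStructure hs hnd).indexAt y) k y)) ≤ (⨆ y : N, ∑ k, Complex.normSq ((h.unitaryAdaptedFrames hs hnd).canonicalTorsion ((h.canonicalSpincStructure hs hnd).indexAt y) y ((h.canonicalSpincStructure hs hnd).frame ((h.canonicalSpincStructure hs hnd).indexAt y) k y))) :=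
      le_ciSup hbdd y
    have hA0 : 0 ≤ ∑ k, Complex.normSq (connDeriv (h.alphaFun hs hnd cfg) (h.halfConnectionDiff hs hnd cfg) y ((h.canonicalSpincStructure hs hnd).frame ((h.canonicalSpincStructure hs hnd).indexAt y) k y)) :=
      Finset.sum_nonneg fun k _ ↦ Complex.normSq_nonneg _
    have hb : Complex.normSq (cfg.plusSpinor ((h.canonicalSpincStructure hs hnd).indexAt y) y 0) = h.betaSq hs hnd cfg y := rfl
    rw [hb] at hcs
    have h16 : 0 ≤ 16 / Complex.normSq c := by positivity
    have hprod := mul_le_mul_of_nonneg_left (mul_le_mul_of_nonneg_left hτ hA0) h16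
    have hdiv : (1 - 16 * (⨆ y : N, ∑ k, Complex.normSq ((h.unitaryAdaptedFrames hs hnd).canonicalTorsion ((h.canonicalSpincStructure hs hnd).indexAt y) y ((h.canonicalSpincStructure hs hnd).frame ((h.canonicalSpincStructure hs hnd).indexAt y) k y))) / Complex.normSq c) * (∑ k, Complex.normSq (connDeriv (h.alphaFun hs hnd cfg) (h.halfConnectionDiff hs hnd cfg) y ((h.canonicalSpincStructure hs hnd).frame ((h.canonicalSpincStructure hs hnd).indexAt y) k y))) =
        (∑ k, Complex.normSq (connDeriv (h.alphaFun hs hnd cfg) (h.halfConnectionDiff hs hnd cfg) y ((h.canonicalSpincStructure hs hnd).frame ((h.canonicalSpincStructure hs hnd).indexAt y) k y))) -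
          16 / Complex.normSq c * ((∑ k, Complex.normSq (connDeriv (h.alphaFun hs hnd cfg) (h.halfConnectionDiff hs hnd cfg) y ((h.canonicalSpincStructure hs hnd).frame ((h.canonicalSpincStructure hs hnd).indexAt y) k y))) * (⨆ y : N, ∑ k, Complex.normSq ((h.unitaryAdaptedFrames hs hnd).canonicalTorsion ((h.canonicalSpincStructure hs hnd).indexAt y) y ((h.canonicalSpincStructure hs hnd).frame ((h.canonicalSpincStructure hs hnd).indexAt y) k y)))) := by
      ring
    rw [hdiv]
    linarith
  have hcoef : 0 < 1 - 16 * (⨆ y : N, ∑ k, Complex.normSq ((h.unitaryAdaptedFrames hs hnd).canonicalTorsion ((h.canonicalSpincStructure hs hnd).indexAt y) y ((h.canonicalSpincStructure hs hnd).frame ((h.canonicalSpincStructure hs hnd).indexAt y) k y))) / Complex.normSq c := by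
    rw [sub_pos, div_lt_one hr0]
    exact hr
  have hnonneg : ∀ y : N, 0 ≤ ((∑ k, Complex.normSq (connDeriv (h.alphaFun hs hnd cfg) (h.halfConnectionDiff hs hnd cfg) y ((h.canonicalSpincStructure hs hnd).frame ((h.canonicalSpincStructure hs hnd).indexAt y) k y))) +
          4⁻¹ * (h.alphaSq hs hnd cfg y - Complex.normSq c) ^ 2 +
          4⁻¹ * h.alphaSq hs hnd cfg y * h.betaSq hs hnd cfg y +
          Complex.normSq c / 4 * h.betaSq hs hnd cfg y -
          2 * ∑ k, (connDeriv (h.alphaFun hs hnd cfg) (h.halfConnectionDiff hs hnd cfg) y ((h.canonicalSpincStructure hs hnd).frame ((h.canonicalSpincStructure hs hnd).indexAt y) k y) * (h.unitaryAdaptedFrames hs hnd).canonicalTorsion ((h.canonicalSpincStructure hs hnd).indexAt y) y ((h.canonicalSpincStructure hs hnd).frame ((h.canonicalSpincStructure hs hnd).indexAt y) k y) * conj (cfg.plusSpinor ((h.canonicalSpincStructure hs hnd).indexAt y) y 0)).re) := by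
    intro y
    refine le_trans ?_ (hlow y)
    have hA0 : 0 ≤ ∑ k, Complex.normSq (connDeriv (h.alphaFun hs hnd cfg) (h.halfConnectionDiff hs hnd cfg) y ((h.canonicalSpincStructure hs hnd).frame ((h.canonicalSpincStructure hs hnd).indexAt y) k y)) :=
      Finset.sum_nonneg fun k _ ↦ Complex.normSq_nonneg _
    have : 0 ≤ h.alphaSq hs hnd cfg y := Complex.normSq_nonneg _
    have := h.betaSq_nonneg hs hnd cfg y
    positivity
  have hzero := eq_zero_of_integral_fun_smul_eq_zero hv hne hnonneg hHs hH0 x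
  have hQ := hlow x
  rw [hzero] at hQ
  have hA0 : 0 ≤ ∑ k, Complex.normSq (connDeriv (h.alphaFun hs hnd cfg) (h.halfConnectionDiff hs hnd cfg) x ((h.canonicalSpincStructure hs hnd).frame ((h.canonicalSpincStructure hs hnd).indexAt x) k x)) := Finset.sum_nonneg fun k _ ↦ Complex.normSq_nonneg _
  have ha0 : 0 ≤ h.alphaSq hs hnd cfg x := Complex.normSq_nonneg _
  have hb0 := h.betaSq_nonneg hs hnd cfg x
  have h1 : (1 - 16 * (⨆ y : N, ∑ k, Complex.normSq ((h.unitaryAdaptedFrames hs hnd).canonicalTorsion ((h.canonicalSpincStructure hs hnd).indexAt y) y ((h.canonicalSpincStructure hs hnd).frame ((h.canonicalSpincStructure hs hnd).indexAt y) k y))) / Complex.normSq c) * (∑ k, Complex.normSq (connDeriv (h.alphaFun hs hnd cfg) (h.halfConnectionDiff hs hnd cfg) x ((h.canonicalSpincStructure hs hnd).frame ((h.canonicalSpincStructure hs hnd).indexAt x) k x))) = 0 := by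
    nlinarith [mul_nonneg hcoef.le hA0, sq_nonneg (h.alphaSq hs hnd cfg x - Complex.normSq c), mul_nonneg ha0 hb0]
  have hsum0 : ∑ k, Complex.normSq (connDeriv (h.alphaFun hs hnd cfg) (h.halfConnectionDiff hs hnd cfg) x ((h.canonicalSpincStructure hs hnd).frame ((h.canonicalSpincStructure hs hnd).indexAt x) k x)) = 0 := by
    rcases mul_eq_zero.1 h1 with h' | h'
    · exact absurd h' hcoef.ne'
    · exact h'
  have h2 : (h.alphaSq hs hnd cfg x - Complex.normSq c) ^ 2 = 0 := by
    nlinarith [mul_nonneg hcoef.le hA0, sq_nonneg (h.alphaSq hs hnd cfg x - Complex.normSq c), mul_nonneg ha0 hb0]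
  have ha : h.alphaSq hs hnd cfg x = Complex.normSq c := by nlinarith
  have h3 : h.alphaSq hs hnd cfg x * h.betaSq hs hnd cfg x = 0 := by
    nlinarith [mul_nonneg hcoef.le hA0, sq_nonneg (h.alphaSq hs hnd cfg x - Complex.normSq c), mul_nonneg ha0 hb0]
  refine ⟨fun k ↦ ?_, ha, ?_⟩
  · exact Complex.normSq_eq_zero.1 ((Finset.sum_eq_zero_iff_of_nonneg fun l _ ↦ Complex.normSq_nonneg
      (connDeriv (h.alphaFun hs hnd cfg) (h.halfConnectionDiff hs hnd cfg) x
        ((h.canonicalSpincStructure hs hnd).frame ((h.canonicalSpincStructure hs hnd).indexAt x) l x))).1 hsum0 k (Finset.mem_univ k))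
  · rw [ha] at h3
    rcases mul_eq_zero.1 h3 with h' | h'
    · exact absurd h' hr0.ne'
    · exact h'

end AlmostComplexStructure.IsCompatibleWith

end Literature.Geometry.Symplectic

end
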